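import Summits.RiemannHypothesis.RiemannHypothesis.Theorems.Splittings.NbTargetsDilation
import Literature.Analysis.FunctionSpaces.PlancherelL1L2
import HarnessLib

/-!
# RH-EQUIVALENT·SPLITTING CENSUS (nb, neg) · V44 «DILATIONS > 1 / WIENER COLLAPSE», part A:
the Nyman–Beurling closure over an UNBOUNDED dilation menu holds unconditionally; nothing here
bears on the truth of RH

LABEL (line 1): RH-EQUIVALENT·SPLITTING (cell `rh-split`, seat (nb, neg), generation 19, census
candidate V44).  Every earlier census row (V1–V43) keeps Báez-Duarte's dilation menu
`Θ = {1/(k+1) : k ∈ ℕ} ⊂ (0,1]` (or a sub-menu of it) for the approximating functions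
`ρ_θ(x) = {θ/x}`.  This file moves the DILATION axis: for a positive sequence `θ : ℕ → ℝ` put
`Θ_θ = {θ_j/(k+1) : j, k ∈ ℕ}` and write NB(Θ) for «`χ = 𝟙_(0,1]` is an `L²(0,∞)`-limit of real
combinations of `x ↦ {t/x}`, `t ∈ Θ`» (spelled out in `ε`-form exactly as in
`Literature.NumberTheory.LFunctions.baezDuarte_iff`, with a rectangular coefficient array
`c : Fin J → Fin N → ℝ`).

MAIN THEOREM (`nb_unbounded_dilations`, RH-free): if `θ` is UNBOUNDED then NB(Θ_θ) holds — in fact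
the complex span of `{x ↦ {t/x} : t ∈ Θ_θ}` is dense in all of `L²(0,∞)`.  In particular
(`nb_dilations_pow`) for every real `q > 1` the menu `{q^j/(k+1)}` — Báez-Duarte's menu with ONE
expanding dilation adjoined — already collapses.  Proof (Wiener's `L²` Tauberian theorem, made
explicit): in logarithmic coordinates `x = e^{-u}` the map `A ↦ (u ↦ e^{-u/2}A(e^{-u}))` is an
isometry `L²((0,∞),dx) → L²(ℝ,du)` carrying `ρ_t` to `t^{1/2}` times the translate by `-log t` of
`ψ(u) = e^{-u/2}{e^u} ∈ L¹ ∩ L²`, whose Fourier transform is `ξ ↦ -ζ(s)/s`, `s = 1/2 + 2πiξ`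
(Mathlib's `mellin_eq_fourier` and the tree's `hasMellin_fract_one_div_mul`).  If `φ ∈ L²(ℝ)` is
orthogonal to all generators then, by Plancherel on `L²` (Mathlib's `Lp.inner_fourier_eq`) and the
tree's identification of the `L²`-Fourier transform with the Fourier integral on `L¹ ∩ L²`
(`Literature.Analysis.FunctionSpaces.fourier_toLp_ae_eq_fourierIntegral`), the integrable function
`H = conj(ζ(s)/s)·𝓕φ` has Fourier integral vanishing on `log Θ_θ = {log θ_j - log(k+1)}`, which is
DENSE in `ℝ` because `θ` is unbounded (`exists_abs_log_div_sub_lt`); so `𝓕H ≡ 0`, `H = 0` a.e.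
(pairing with Schwartz functions, `ae_eq_zero_of_forall_fourierIntegral_eq_zero`), hence `𝓕φ = 0`
a.e. since `ζ(1/2+it) ≠ 0` for a.e. `t` (tree `ae_riemannZeta_half_ne_zero`), hence `φ = 0`.
`Kᗮ = ⊥` gives density (`Submodule.topologicalClosure_eq_top_iff`), and the isometry pulls an
`ε`-approximation back to `(0,∞)`; real parts of the coefficients suffice.

Part B (`NbDilationB.lean`) proves the complementary fact: for an INTEGER `q ≥ 1` and a FINITE
number `J ≥ 1` of powers, NB(`{q^j/(k+1) : j < J}`) `⟺` RH.  Together: on the dilation axis the RH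
content of `E_NB` is exactly the BOUNDEDNESS of the menu — a split `A ∧ B ⟹ RH` with
`A =` NB(unbounded menu) is DECORATION (A is a theorem), with `A =` NB(bounded menu ⊇ {1/(k+1)})
a COSTUME (A ⟺ RH).

Kernel hygiene: no `sorry`, no new axioms, no `private`, no instances, no notation; every
statement spelled out over Mathlib + landed tree declarations.
-/

open MeasureTheory Set Filter Complex FourierTransform SchwartzMap
open scoped ENNReal Topology Real ComplexConjugate InnerProductSpace

set_option linter.dupNamespace false

namespace Summit.RiemannHypothesis.RiemannHypothesis.Theorems.Splittings.NbDilation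

open Literature.NumberTheory.LFunctions Literature.NumberTheory.LFunctions.BaezDuarteOnlyIf
  Literature.Analysis.FunctionSpaces
  Summit.RiemannHypothesis.RiemannHypothesis.Theorems.Splittings.NbTargets

/-! ## 1. The logarithms of an unbounded menu are dense -/

/-- **Density of `log Θ_θ`.**  If `θ : ℕ → ℝ` is positive and unbounded then the numbers
`log(θ_j/(k+1))` come `δ`-close to every real `x`: take `θ_j e^{-x} > δ⁻¹ + 2` and
`k + 1 = ⌊θ_j e^{-x}⌋`. [folklore] -/
theorem exists_abs_log_div_sub_lt (θ : ℕ → ℝ) (hθ : ∀ j, 0 < θ j)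
    (hunb : ∀ T : ℝ, ∃ j, T < θ j) (x : ℝ) {δ : ℝ} (hδ : 0 < δ) :
    ∃ j k : ℕ, |Real.log (θ j / ((k : ℝ) + 1)) - x| < δ := by
  obtain ⟨j, hj⟩ := hunb ((δ⁻¹ + 2) * Real.exp x)
  set y : ℝ := θ j * Real.exp (-x) with hy
  have hδi : 0 < δ⁻¹ := inv_pos.2 hδ
  have hy1 : δ⁻¹ + 2 < y := by
    have h := mul_lt_mul_of_pos_right hj (Real.exp_pos (-x))
    rwa [mul_assoc, ← Real.exp_add, add_neg_cancel, Real.exp_zero, mul_one] at h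
  have hy0 : 0 < y := by linarith
  set n : ℕ := ⌊y⌋₊ with hn
  have hny : (n : ℝ) ≤ y := Nat.floor_le hy0.le
  have hyn : y < n + 1 := Nat.lt_floor_add_one y
  have hn1 : (1 : ℝ) < n := by linarith
  have hn0 : (0 : ℝ) < n := by linarith
  have hnat : 1 ≤ n := by exact_mod_cast hn1.le
  refine ⟨j, n - 1, ?_⟩
  have hcast : (((n - 1 : ℕ) : ℝ) + 1) = n := by
    rw [Nat.cast_sub hnat]; push_cast; ring
  rw [hcast]
  have hlog : Real.log (θ j / n) - x = Real.log (y / n) := by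
    rw [Real.log_div (hθ j).ne' hn0.ne', Real.log_div hy0.ne' hn0.ne', hy,
      Real.log_mul (hθ j).ne' (Real.exp_pos _).ne', Real.log_exp]
    ring
  rw [hlog]
  have h1 : 1 ≤ y / n := by rw [le_div_iff₀ hn0]; linarith
  have hpos : 0 < y / n := by positivity
  rw [abs_of_nonneg (Real.log_nonneg h1)]
  have h2 : Real.log (y / n) ≤ y / n - 1 := Real.log_le_sub_one_of_pos hpos
  have h3 : y / n - 1 < (n : ℝ)⁻¹ := by
    rw [div_sub_one hn0.ne', div_lt_iff₀ hn0, inv_mul_cancel₀ hn0.ne']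
    linarith
  have h4 : (n : ℝ)⁻¹ < δ := by
    have h5 : δ⁻¹ < n := by linarith
    calc (n : ℝ)⁻¹ < δ⁻¹⁻¹ := (inv_lt_inv₀ hn0 hδi).2 h5
      _ = δ := inv_inv δ
  linarith

/-! ## 2. Logarithmic coordinates: `A ↦ (u ↦ e^{-u/2} A(e^{-u}))` -/

/-- The substitution `x = e^{-u}` on squares of norms (`∫⁻` form):
`∫_0^∞ ‖A x‖² dx = ∫_ℝ ‖e^{-u/2} A(e^{-u})‖² du`. [folklore] -/
theorem lintegral_Ioi_enorm_sq_eq (A : ℝ → ℂ) :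
    ∫⁻ x in Ioi 0, ‖A x‖ₑ ^ 2 =
      ∫⁻ u : ℝ, ‖Real.exp (-(1 / 2 : ℝ) * u) • A (Real.exp (-u))‖ₑ ^ 2 := by
  rw [← image_exp_neg_univ, lintegral_image_eq_lintegral_abs_deriv_mul MeasurableSet.univ
    hasDerivWithinAt_exp_neg injOn_exp_neg, Measure.restrict_univ]
  refine lintegral_congr fun u ↦ ?_
  have hsq : Real.exp (-(1 / 2 : ℝ) * u) ^ 2 = Real.exp (-u) := by
    rw [sq, ← Real.exp_add]; congr 1; ring
  rw [Function.comp_apply, abs_neg, abs_of_pos (Real.exp_pos _), enorm_smul, mul_pow,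
    Real.enorm_eq_ofReal (Real.exp_nonneg _), ← ENNReal.ofReal_pow (Real.exp_nonneg _), hsq]

/-- The substitution `x = e^{-u}` is an `L²`-isometry:
`‖A‖_{L²((0,∞))} = ‖u ↦ e^{-u/2}A(e^{-u})‖_{L²(ℝ)}`. [folklore] -/
theorem eLpNorm_Ioi_eq_eLpNorm_logPull (A : ℝ → ℂ) :
    eLpNorm A 2 (volume.restrict (Ioi 0)) =
      eLpNorm (fun u : ℝ ↦ Real.exp (-(1 / 2 : ℝ) * u) • A (Real.exp (-u))) 2 volume := by
  rw [eLpNorm_eq_lintegral_rpow_enorm_toReal two_ne_zero ENNReal.ofNat_ne_top,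
    eLpNorm_eq_lintegral_rpow_enorm_toReal two_ne_zero ENNReal.ofNat_ne_top]
  simp only [ENNReal.toReal_ofNat, ENNReal.rpow_two, one_div]
  rw [lintegral_Ioi_enorm_sq_eq A]
  simp

/-- Measurability is preserved by the logarithmic substitution. [folklore] -/
theorem measurable_logPull {A : ℝ → ℂ} (hA : Measurable A) :
    Measurable fun u : ℝ ↦ Real.exp (-(1 / 2 : ℝ) * u) • A (Real.exp (-u)) :=
  (Real.measurable_exp.comp (measurable_id.const_mul _)).smul
    (hA.comp (Real.measurable_exp.comp measurable_neg))

/-- `L²` membership is preserved by the logarithmic substitution. [folklore] -/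
theorem memLp_logPull {A : ℝ → ℂ} (hA : Measurable A)
    (h2 : MemLp A 2 (volume.restrict (Ioi 0))) :
    MemLp (fun u : ℝ ↦ Real.exp (-(1 / 2 : ℝ) * u) • A (Real.exp (-u))) 2 volume :=
  ⟨(measurable_logPull hA).aestronglyMeasurable, by
    rw [← eLpNorm_Ioi_eq_eLpNorm_logPull]; exact h2.2⟩

/-- The logarithmic substitution carries absolutely convergent Mellin transforms on the critical
line to `L¹(ℝ)`: if `∫_0^∞ ‖A x‖ x^{-1/2} dx < ∞` then `u ↦ e^{-u/2}A(e^{-u}) ∈ L¹(ℝ)`. [folklore] -/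
theorem integrable_logPull {A : ℝ → ℂ} (hA : MellinConvergent A ((1 / 2 : ℝ) : ℂ)) :
    Integrable fun u : ℝ ↦ Real.exp (-(1 / 2 : ℝ) * u) • A (Real.exp (-u)) := by
  have h := (integrableOn_Ioi_iff_integrable_exp_neg_smul _).1 hA
  refine h.congr (Eventually.of_forall fun u ↦ ?_)
  have hpos : 0 < Real.exp (-u) := Real.exp_pos _
  simp only
  rw [show ((1 / 2 : ℝ) : ℂ) - 1 = (((1 / 2 : ℝ) - 1 : ℝ) : ℂ) by push_cast; ring,
    ← ofReal_cpow hpos.le, Complex.coe_smul, smul_smul, exp_neg_mul_exp_neg_rpow]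

/-- **Fourier = Mellin in logarithmic coordinates**:
`𝓕[u ↦ e^{-u/2}A(e^{-u})](ξ) = 𝓜A(1/2 + 2πiξ)` (Mathlib's `mellin_eq_fourier`). [folklore] -/
theorem fourier_logPull_eq_mellin (A : ℝ → ℂ) (ξ : ℝ) :
    𝓕 (fun u : ℝ ↦ Real.exp (-(1 / 2 : ℝ) * u) • A (Real.exp (-u))) ξ =
      mellin A (((1 / 2 : ℝ) : ℂ) + ((2 * π * ξ : ℝ) : ℂ) * I) := by
  rw [mellin_eq_fourier]
  have hre : (((1 / 2 : ℝ) : ℂ) + ((2 * π * ξ : ℝ) : ℂ) * I).re = 1 / 2 := by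
    simp
  have him : (((1 / 2 : ℝ) : ℂ) + ((2 * π * ξ : ℝ) : ℂ) * I).im / (2 * π) = ξ := by
    have hπ : (2 * π : ℝ) ≠ 0 := by positivity
    simp only [add_im, ofReal_im, mul_im, ofReal_re, I_im, mul_one, I_re, mul_zero, add_zero,
      zero_add]
    field_simp
  rw [hre, him]

/-! ## 3. The generators `ρ_t(x) = {t/x}` -/

/-- `{1/(t⁻¹x)} = {t/x}`. [folklore] -/
theorem fract_one_div_inv_mul (t x : ℝ) : Int.fract (1 / (t⁻¹ * x)) = Int.fract (t / x) := by
  rw [one_div, mul_inv, inv_inv, div_eq_mul_inv]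

/-- Mellin transform of `x ↦ {t/x}` (`t > 0`) on `0 < re s < 1`: `𝓜ρ_t(s) = -t^{s}ζ(s)/s`, in
the tree's normal form `(t⁻¹)^{-s}·(-ζ(s)/s)` (`hasMellin_fract_one_div_mul`).
[cite: Titchmarsh1986, §2.1 (2.1.5)] -/
theorem hasMellin_fract_div {t : ℝ} (ht : 0 < t) {s : ℂ} (hs0 : 0 < s.re) (hs1 : s.re < 1) :
    HasMellin (fun x : ℝ ↦ ((Int.fract (t / x) : ℝ) : ℂ)) s
      (((t⁻¹ : ℝ) : ℂ) ^ (-s) * (-riemannZeta s / s)) := by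
  have h := hasMellin_fract_one_div_mul (inv_pos.2 ht) hs0 hs1
  simp_rw [fract_one_div_inv_mul] at h
  exact h

/-- `x ↦ {t/x}` is measurable. [folklore] -/
theorem measurable_fract_div (t : ℝ) : Measurable fun x : ℝ ↦ ((Int.fract (t / x) : ℝ) : ℂ) :=
  measurable_ofReal.comp (measurable_const.div measurable_id).fract

/-- `x ↦ {t/x}` lies in `L²((0,∞))` for every `t > 0` (dilate of `{1/x}`, tree
`memLp_two_fract_one_div` and `eLpNorm_comp_mul_left_Ioi`). [folklore] -/
theorem memLp_two_fract_div {t : ℝ} (ht : 0 < t) :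
    MemLp (fun x : ℝ ↦ ((Int.fract (t / x) : ℝ) : ℂ)) 2 (volume.restrict (Ioi 0)) := by
  have h1 : MemLp (fun x : ℝ ↦ Int.fract (1 / (1 * x))) 2 (volume.restrict (Ioi (0 : ℝ))) :=
    memLp_two_fract_one_div le_rfl
  have hmeas : Measurable fun x : ℝ ↦ Int.fract (1 / (1 * x)) :=
    (measurable_const.div (measurable_const.mul measurable_id)).fract
  have hscale := eLpNorm_comp_mul_left_Ioi hmeas (inv_pos.2 ht)
  have heq : (fun x : ℝ ↦ Int.fract (1 / (1 * (t⁻¹ * x)))) = fun x : ℝ ↦ Int.fract (t / x) := by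
    funext x; rw [one_mul, fract_one_div_inv_mul]
  rw [heq] at hscale
  have hreal : MemLp (fun x : ℝ ↦ Int.fract (t / x)) 2 (volume.restrict (Ioi 0)) := by
    refine ⟨(measurable_const.div measurable_id).fract.aestronglyMeasurable, ?_⟩
    rw [hscale]
    exact ENNReal.mul_lt_top (ENNReal.rpow_lt_top_of_nonneg (by norm_num) ENNReal.ofReal_ne_top)
      h1.2
  exact hreal.ofReal

/-- The log-pulled generator `u ↦ e^{-u/2}{t e^{u}}` is in `L¹(ℝ)` (`t > 0`). [folklore] -/
theorem integrable_gen {t : ℝ} (ht : 0 < t) :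
    Integrable fun u : ℝ ↦ Real.exp (-(1 / 2 : ℝ) * u) •
      (((Int.fract (t / Real.exp (-u)) : ℝ) : ℂ)) :=
  integrable_logPull (A := fun x : ℝ ↦ ((Int.fract (t / x) : ℝ) : ℂ))
    (hasMellin_fract_div ht (s := ((1 / 2 : ℝ) : ℂ)) (by simp) (by simp; norm_num)).1

/-- The log-pulled generator `u ↦ e^{-u/2}{t e^{u}}` is in `L²(ℝ)` (`t > 0`). [folklore] -/
theorem memLp_gen {t : ℝ} (ht : 0 < t) :
    MemLp (fun u : ℝ ↦ Real.exp (-(1 / 2 : ℝ) * u) •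
      (((Int.fract (t / Real.exp (-u)) : ℝ) : ℂ))) 2 volume :=
  memLp_logPull (measurable_fract_div t) (memLp_two_fract_div ht)

/-- **Fourier transform of the generator**: for `t > 0`,
`𝓕[u ↦ e^{-u/2}{t e^u}](ξ) = (t⁻¹)^{-s}·𝓜ρ_1(s)`, `s = 1/2 + 2πiξ`, where
`𝓜ρ_1(s) = -ζ(s)/s`. [cite: Titchmarsh1986, §2.1 (2.1.5)] -/
theorem fourier_gen_eq {t : ℝ} (ht : 0 < t) (ξ : ℝ) :
    𝓕 (fun u : ℝ ↦ Real.exp (-(1 / 2 : ℝ) * u) •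
        (((Int.fract (t / Real.exp (-u)) : ℝ) : ℂ))) ξ =
      ((t⁻¹ : ℝ) : ℂ) ^ (-(((1 / 2 : ℝ) : ℂ) + ((2 * π * ξ : ℝ) : ℂ) * I)) *
        mellin (fun x : ℝ ↦ ((Int.fract (1 / x) : ℝ) : ℂ))
          (((1 / 2 : ℝ) : ℂ) + ((2 * π * ξ : ℝ) : ℂ) * I) := by
  have hs0 : 0 < (((1 / 2 : ℝ) : ℂ) + ((2 * π * ξ : ℝ) : ℂ) * I).re := by simp
  have hs1 : (((1 / 2 : ℝ) : ℂ) + ((2 * π * ξ : ℝ) : ℂ) * I).re < 1 := by simp; norm_num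
  rw [fourier_logPull_eq_mellin (fun x : ℝ ↦ ((Int.fract (t / x) : ℝ) : ℂ)),
    (hasMellin_fract_div ht hs0 hs1).2, (hasMellin_fract_div one_pos hs0 hs1).2]
  simp

/-- The generator in the tree's normal form: `(t⁻¹)^{-s}` on the critical line is
`√t · e^{2πiξ log t}` (`t > 0`, `s = 1/2 + 2πiξ`). [folklore] -/
theorem inv_cpow_neg_line {t : ℝ} (ht : 0 < t) (ξ : ℝ) :
    ((t⁻¹ : ℝ) : ℂ) ^ (-(((1 / 2 : ℝ) : ℂ) + ((2 * π * ξ : ℝ) : ℂ) * I)) =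
      ((Real.sqrt t : ℝ) : ℂ) * Complex.exp (((2 * π * ξ * Real.log t : ℝ) : ℂ) * I) := by
  have ht' : ((t⁻¹ : ℝ) : ℂ) ≠ 0 := by exact_mod_cast (inv_pos.2 ht).ne'
  rw [cpow_def_of_ne_zero ht', ← ofReal_log (inv_pos.2 ht).le, Real.log_inv,
    Real.sqrt_eq_rpow, Real.rpow_def_of_pos ht, Complex.ofReal_exp, ← Complex.exp_add]
  congr 1
  push_cast
  ring

/-- Its complex conjugate: `conj((t⁻¹)^{-s}) = √t · e^{-2πiξ log t}`. [folklore] -/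
theorem conj_inv_cpow_neg_line {t : ℝ} (ht : 0 < t) (ξ : ℝ) :
    conj (((t⁻¹ : ℝ) : ℂ) ^ (-(((1 / 2 : ℝ) : ℂ) + ((2 * π * ξ : ℝ) : ℂ) * I))) =
      ((Real.sqrt t : ℝ) : ℂ) * Complex.exp (((-2 * π * ξ * Real.log t : ℝ) : ℂ) * I) := by
  rw [inv_cpow_neg_line ht, map_mul, Complex.conj_ofReal, ← Complex.exp_conj, map_mul,
    Complex.conj_ofReal, Complex.conj_I]
  congr 2
  push_cast
  ring

end Summit.RiemannHypothesis.RiemannHypothesis.Theorems.Splittings.NbDilation
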